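import Summits.MatrixMultiplication.MatrixMultiplication.Theorems.AbelianSTPPCensusTAStatFSplit

/-!
# T_A static certificate, range `6780 … 6833` (multi-parameter k-member tree at `τ = 2371/1000`): kernel pieces of the cells `(12, 17, 20)`, `(15, 16, 17)` (volume `4080`) at the orders `6792 … 6794`, part 1/1

Cell mm-stpp (rung F-M1), tier T_A = «beat `2.371`, the record exponent (ADVXXZ'25 / DEK+26 rounded)»; seat mm-stpp-vp-p2 (gen 7).  Root-split layout (`AbelianSTPPCensusTAStatKMemberXSplit.lean`, `…XWalk.lean`, `AbelianSTPPCensusTAStatFSplit.lean`): the (cell, order) tree(s) have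
0 nodes — beyond one `decide` — and is cut along list positions into `goIR` pieces / small subtrees / descent children of ≤ 4·10⁴ nodes each
(this file: 6 pieces, 0 nodes; sizes from the exact twin seat twin/tastat9.py, kit j314549), assembled in `AbelianSTPPCensusTAStatFCkS4080o6792t6794.lean`.
`decide` with kernel reduction (standard axioms; no `native_decide`), `Elab.async false`.
WHAT THIS IS NOT: arithmetic on shape lists only; no statement about STPP families or `ω`.
-/

set_option linter.dupNamespace false
set_option autoImplicit false
set_option Elab.async false

namespace Summit.MatrixMultiplication.MatrixMultiplication.Theorems.TAStatF

open ShapeCert (gainOf2371j)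
open TECert (vol)

set_option maxHeartbeats 0 in
/-- the root of `(12, 17, 20)` bucket `70` at order `6792` (0 nodes) [original] -/
theorem s4080o6792x0b70r : TAStatKM.rootKX tb m2l gainOf2371j (rowOf 4080) (xrowOf 4080) (gainOf2371j 4080) 784 4080 1519 12 204 6792 kmax 70 69 = true := by decide +kernel

set_option maxHeartbeats 0 in
/-- the root of `(15, 16, 17)` bucket `70` at order `6792` (0 nodes) [original] -/
theorem s4080o6792x1b70r : TAStatKM.rootKX tb m2l gainOf2371j (rowOf 4080) (xrowOf 4080) (gainOf2371j 4080) 767 4080 1486 15 240 6792 kmax 70 70 = true := by decide +kernel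

set_option maxHeartbeats 0 in
/-- the root of `(12, 17, 20)` bucket `70` at order `6793` (0 nodes) [original] -/
theorem s4080o6793x0b70r : TAStatKM.rootKX tb m2l gainOf2371j (rowOf 4080) (xrowOf 4080) (gainOf2371j 4080) 784 4080 1519 12 204 6793 kmax 70 69 = true := by decide +kernel

set_option maxHeartbeats 0 in
/-- the root of `(15, 16, 17)` bucket `70` at order `6793` (0 nodes) [original] -/
theorem s4080o6793x1b70r : TAStatKM.rootKX tb m2l gainOf2371j (rowOf 4080) (xrowOf 4080) (gainOf2371j 4080) 767 4080 1486 15 240 6793 kmax 70 70 = true := by decide +kernel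

set_option maxHeartbeats 0 in
/-- the root of `(12, 17, 20)` bucket `70` at order `6794` (0 nodes) [original] -/
theorem s4080o6794x0b70r : TAStatKM.rootKX tb m2l gainOf2371j (rowOf 4080) (xrowOf 4080) (gainOf2371j 4080) 784 4080 1519 12 204 6794 kmax 70 69 = true := by decide +kernel

set_option maxHeartbeats 0 in
/-- the root of `(15, 16, 17)` bucket `70` at order `6794` (0 nodes) [original] -/
theorem s4080o6794x1b70r : TAStatKM.rootKX tb m2l gainOf2371j (rowOf 4080) (xrowOf 4080) (gainOf2371j 4080) 767 4080 1486 15 240 6794 kmax 70 70 = true := by decide +kernel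

end Summit.MatrixMultiplication.MatrixMultiplication.Theorems.TAStatF
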